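import Summits.CriticalPhenomena.PercolationContinuityZ3.Theorems.PercNonProliferationSubpolynomialBlockingSubsurface
import HarnessLib

/-!
# `SubpolynomialBlocking` — no blocking surface tension at `p_c(ℤ³)` (corollary of the sub-surface floor)

Support file for crux item stmt-CriticalPhenomena-4446, line `slab-ladder-two-curtains`, lead c2: the limit form of
`subsurfaceBlocking` (`…SubpolynomialBlockingSubsurface.lean`): `n⁻² log (1/u_n(p_c)) → 0`. For `p > p_c` blocking is
exponentially rare (`Negative.blockProb_le_exp_of_criticalProb_lt`); a first-order world with positive interface tension would
have a positive limit here — Barsky–Grimmett–Newman's `θ_ℍ(p_c) = 0` excludes exactly that much.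
-/

noncomputable section

namespace Summit.CriticalPhenomena.PercolationContinuityZ3.Theorems.SubpolynomialBlocking

open MeasureTheory Filter Topology
open Literature.Probability.Percolation Literature.Probability.LatticeModels

/-- **No blocking surface tension at `p_c(ℤ³)`**: `n⁻² log (1/u_n) → 0` (from `subsurfaceBlocking` and `u_n ≤ 1`),
whereas for `p > p_c` the blocking probability is exponentially small (`Negative.blockProb_le_exp_of_criticalProb_lt`)
and in a first-order world with positive interface tension the limit would be positive. -/
theorem tendsto_log_inv_blockProb_div_sq :
    Tendsto (fun n : ℕ => Real.log ((bondPercolation (zdGraph 3) (criticalProbI 3)).real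
        {ω | ¬ ∃ x ∈ box 3 n, ∃ y ∈ innerBoundary (zdGraph 3) (box 3 (2 * n)),
          ω ∈ openConnIn ↑(box 3 (2 * n)) x y})⁻¹ / (n : ℝ) ^ 2) atTop (𝓝 0) := by
  rw [Metric.tendsto_atTop]
  intro ε hε
  have h := subsurfaceBlocking (ε / 2) (by linarith)
  rw [eventually_atTop] at h
  obtain ⟨N, hN⟩ := h
  refine ⟨max N 1, fun n hn => ?_⟩
  have hnN : N ≤ n := le_trans (le_max_left _ _) hn
  have hn1 : 1 ≤ n := le_trans (le_max_right _ _) hn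
  have hn0 : (0 : ℝ) < (n : ℝ) ^ 2 := by positivity
  set u : ℝ := (bondPercolation (zdGraph 3) (criticalProbI 3)).real
        {ω | ¬ ∃ x ∈ box 3 n, ∃ y ∈ innerBoundary (zdGraph 3) (box 3 (2 * n)),
          ω ∈ openConnIn ↑(box 3 (2 * n)) x y} with hu
  have hexp : Real.exp (-(ε / 2 * (n : ℝ) ^ 2)) ≤ u := hN n hnN
  have hu0 : 0 < u := lt_of_lt_of_le (Real.exp_pos _) hexp
  have hu1 : u ≤ 1 := measureReal_le_one
  have hlog0 : 0 ≤ Real.log u⁻¹ := Real.log_nonneg (one_le_inv_iff₀.2 ⟨hu0, hu1⟩)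
  have hlog1 : Real.log u⁻¹ ≤ ε / 2 * (n : ℝ) ^ 2 := by
    rw [Real.log_inv, neg_le]
    have := Real.log_le_log (Real.exp_pos _) hexp
    rwa [Real.log_exp] at this
  rw [Real.dist_eq, sub_zero, abs_of_nonneg (div_nonneg hlog0 hn0.le), div_lt_iff₀ hn0]
  nlinarith

end Summit.CriticalPhenomena.PercolationContinuityZ3.Theorems.SubpolynomialBlocking

end
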